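import Summits.Ventures.PercRepro.S2NineCaps

/-!
# PercRepro — S2: THE CIRCUIT CAPS AT CORANK `10` — THE CELLS `(13, 10)`, `(12, 10)` AND `(11, 10)` (p7, gen 19; sub-claim S2; the row `p = 13`)

The caps the cells of corank `10` feed to the kit: on the coloop-free `e`-free core of rank `13` on `23` points `s₃ ≤ 20` (`TriangleCap.cq3 10`),
`s₄ ≤ 167 = ⌊23·138/19⌋` (the averaging recursion on `avgChain16 9 = 138`), `s₅ ≤ 1293 = ⌊23·1012/18⌋`
(on `avgChain5b 9 = 1012`) — **`caps_thirteen_ten_cf`**; on the scaled coloop-free cell `(12, 10)` (`22` points) `20 / 168 / 1309` —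
**`caps_twelve_ten_cf`**; on the twice-scaled cell `(11, 10)` (`21` points, coloops allowed) the plain nullity-`10` caps `20 / 188 / 1518`
(`avgChain16 10`, `avgChain5b 10`) — **`caps_eleven_ten`**. Nothing about any cell is claimed. Axioms: standard.
-/

open scoped Matroid

namespace PercRepro

namespace ThmN

open Set

variable {α : Type}

/-- The coloop-free caps at `(13, 10)`: `s₃ ≤ 20`, `s₄ ≤ 167` (`⌊23·138/19⌋` on `avgChain16 9`), `s₅ ≤ 1293` (`⌊23·1012/18⌋`). -/
theorem caps_thirteen_ten_cf (M : Matroid α) [M.Finite]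
    (hd : M.E.encard = M.eRank + ((10 : ℕ) : ℕ∞)) (hn : M.E.ncard = 13 + 10)
    (hfree : ∀ e ∈ M.E, ∃ A ⊆ M.E \ {e}, e ∉ M.closure A ∧ e ∉ M.closure ((M.E \ {e}) \ A)) (hK : ∀ e, ¬ M.IsColoop e) :
    {C : Set α | M.IsCircuit C ∧ C.ncard = 3}.ncard ≤ 20 ∧
      {C : Set α | M.IsCircuit C ∧ C.ncard = 4}.ncard ≤ 167 ∧
        {C : Set α | M.IsCircuit C ∧ C.ncard = 5}.ncard ≤ 1293 := by
  have hs3 := TriangleCap.core_ncard_triangles_le_cq3 M hfree hd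
  rw [show TriangleCap.cq3 10 = 20 by decide] at hs3
  have hcol : M.coloops = ∅ := S2.coloops_eq_empty_of_forall_not M hK
  have hm : 23 ≤ (M.E \ M.coloops).ncard := by
    rw [hcol, Set.sdiff_empty, hn]
  have hd' : M.E.encard = M.eRank + (((9 : ℕ) : ℕ∞) + 1) := by
    rw [hd]; norm_num
  have h := S1.ncard_fourCircuits_sub_div_le_of_nonColoops M hfree hd' (by norm_num) hm (B := 138)
    (fun M' _ hfree' hd'' => by
      have h := ncard_fourCircuits_le_avgChain16 9 M' hfree' hd''
      rw [show avgChain16 9 = 138 by decide] at h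
      exact h)
  have hs4 : {C : Set α | M.IsCircuit C ∧ C.ncard = 4}.ncard ≤ 167 := by
    have := S1.le_mul_div_of_sub_div_le (by norm_num : 4 < 23) h
    omega
  have hs5 := S2.ncard_fiveCircuits_le_of_no_coloop M hfree hd' hK (by omega)
  rw [hn] at hs5
  have h5 : (13 + 10) * S1.avgChain5b 9 / (13 + 10 - 5) = 1293 := by
    rw [show S1.avgChain5b 9 = 1012 by decide]
  rw [h5] at hs5
  exact ⟨hs3, hs4, hs5⟩

/-- The coloop-free caps at `(12, 10)`: `s₃ ≤ 20`, `s₄ ≤ 168` (`⌊22·138/18⌋` on `avgChain16 9`), `s₅ ≤ 1309` (`⌊22·1012/17⌋`). -/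
theorem caps_twelve_ten_cf (M : Matroid α) [M.Finite]
    (hd : M.E.encard = M.eRank + ((10 : ℕ) : ℕ∞)) (hn : M.E.ncard = 12 + 10)
    (hfree : ∀ e ∈ M.E, ∃ A ⊆ M.E \ {e}, e ∉ M.closure A ∧ e ∉ M.closure ((M.E \ {e}) \ A)) (hK : ∀ e, ¬ M.IsColoop e) :
    {C : Set α | M.IsCircuit C ∧ C.ncard = 3}.ncard ≤ 20 ∧
      {C : Set α | M.IsCircuit C ∧ C.ncard = 4}.ncard ≤ 168 ∧
        {C : Set α | M.IsCircuit C ∧ C.ncard = 5}.ncard ≤ 1309 := by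
  have hs3 := TriangleCap.core_ncard_triangles_le_cq3 M hfree hd
  rw [show TriangleCap.cq3 10 = 20 by decide] at hs3
  have hcol : M.coloops = ∅ := S2.coloops_eq_empty_of_forall_not M hK
  have hm : 22 ≤ (M.E \ M.coloops).ncard := by
    rw [hcol, Set.sdiff_empty, hn]
  have hd' : M.E.encard = M.eRank + (((9 : ℕ) : ℕ∞) + 1) := by
    rw [hd]; norm_num
  have h := S1.ncard_fourCircuits_sub_div_le_of_nonColoops M hfree hd' (by norm_num) hm (B := 138)
    (fun M' _ hfree' hd'' => by
      have h := ncard_fourCircuits_le_avgChain16 9 M' hfree' hd''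
      rw [show avgChain16 9 = 138 by decide] at h
      exact h)
  have hs4 : {C : Set α | M.IsCircuit C ∧ C.ncard = 4}.ncard ≤ 168 := by
    have := S1.le_mul_div_of_sub_div_le (by norm_num : 4 < 22) h
    omega
  have hs5 := S2.ncard_fiveCircuits_le_of_no_coloop M hfree hd' hK (by omega)
  rw [hn] at hs5
  have h5 : (12 + 10) * S1.avgChain5b 9 / (12 + 10 - 5) = 1309 := by
    rw [show S1.avgChain5b 9 = 1012 by decide]
  rw [h5] at hs5
  exact ⟨hs3, hs4, hs5⟩

/-- The caps at `(11, 10)` (coloops allowed): `s₃ ≤ 20`, `s₄ ≤ 188 = avgChain16 10`, `s₅ ≤ 1518 = avgChain5b 10`. -/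
theorem caps_eleven_ten (M : Matroid α) [M.Finite]
    (hd : M.E.encard = M.eRank + ((10 : ℕ) : ℕ∞))
    (hfree : ∀ e ∈ M.E, ∃ A ⊆ M.E \ {e}, e ∉ M.closure A ∧ e ∉ M.closure ((M.E \ {e}) \ A)) :
    {C : Set α | M.IsCircuit C ∧ C.ncard = 3}.ncard ≤ 20 ∧
      {C : Set α | M.IsCircuit C ∧ C.ncard = 4}.ncard ≤ 188 ∧
        {C : Set α | M.IsCircuit C ∧ C.ncard = 5}.ncard ≤ 1518 := by
  have hs3 := TriangleCap.core_ncard_triangles_le_cq3 M hfree hd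
  rw [show TriangleCap.cq3 10 = 20 by decide] at hs3
  have hs4 := ncard_fourCircuits_le_avgChain16 10 M hfree hd
  rw [show avgChain16 10 = 188 by decide] at hs4
  have hs5 := S1.ncard_fiveCircuits_le_avgChain5b 10 M hfree hd
  rw [show S1.avgChain5b 10 = 1518 by decide] at hs5
  exact ⟨hs3, hs4, hs5⟩

end ThmN

end PercRepro
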